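import Literature.NumberTheory.Sieve.AsymptoticSieveForPrimesAssembly
import Literature.NumberTheory.Sieve.AsymptoticSieveForPrimesBilinearStrong
import Literature.NumberTheory.Sieve.SieveFrameworkProofs
import HarnessLib

/-!
# Asymptotic sieve for primes: the estimate (7.2) of `S₂(x; Y, z)` (proof)

Trunk T-SIEVE. Source: J. Friedlander, H. Iwaniec, *Asymptotic sieve for primes*, Ann. of Math. 148
(1998) 1041–1065 [FriedlanderIwaniecASP1998] (= arXiv:math/9811186), §7 "Estimation of
`S₂(x; Y, Z)`", pp. 1056–1057, displays (7.1)–(7.2).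

This file DISCHARGES the named fact `Literature.NumberTheory.Sieve.fi_asp_S2_estimate` (FI (7.2),
`Literature.NumberTheory.Sieve.AsymptoticSieveForPrimesDecomposition`) outright:
`fi_asp_S2_estimate_holds : fi_asp_S2_estimate`. The only deep input is hypothesis (B) of
Theorem 1, through the proved reduction (B) ⟹ (B′) with the saving it carries,
`SieveSequence.FIAsymptoticSieveHypotheses.reduced_bilinear_bound_pow` (`…BilinearStrong`).

## The printed proof (FI §7) and its formalisation

"In this section and the next we finally encounter the sums where (due to contamination of the
variables coming from the support of `ρ`) it is necessary to perform the integrated estimate.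
Whenever `a_n` occurs we assume `n ≤ x` without writing this condition every time. We have
`S₂(x; y, z) = ∑_e ∑_{y<b≤sy} ∑_{c>z} μ(b)Λ(c)ρ_{ebc} a_{ebc}`,
`|S₂(x; y, z)| ≤ (log x) ∑_k |∑_{y<b≤sy} μ(b)ρ_{bk} a_{bk}|
 ≤ (log x) ∑_{ν₁}∑_{ν₂} |λ_{ν₁ν₂}| ∑_k |∑_{y/ν₂<b≤sy/ν₂} μ(b) a_{ν₁ν₂bk}|`.
In order to remove `ν₂` from the range of the inner summation we take advantage of the integration
over `y` (still not integrating over `z`). (7.1)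
`S₂(x; Y, z) ≤ (log x) ∑∑ |λ_{ν₁ν₂}| ∑_k ∫_{Y/Δ}^{eY} |∑_{y<b≤sy} μ(b) a_{ν₁ν₂bk}| dy/y
 ≤ (log x) ∫_{Y/Δ}^{eY} ∑_ℓ τ₃(ℓ) |∑_{y<b≤sy} μ(b) a_{bℓ}| dy/y`.
By (B′) we conclude that (7.2) `S₂(x; Y, z) ≪ A(x)(log x)^{-1}`."

* Grouping `n = bk` (`sum_Icc_mul_conv_eq`), `∑_{c ∣ k} Λ(c > z) ≤ log k ≤ log x`
  (`truncGT_vonMangoldt_mul_zeta_bounds`), `ρ_{bk} = ∑_{ν₁ ∣ k}∑_{ν₂ ∣ b} λ_{ν₁ν₂}` for squarefree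
  `bk` (`sieveRho_mul_of_squarefree`; non-squarefree `bk` carry `a_{bk} = 0` by (1.16)), the
  substitution `b = ν₂b'` with `μ(ν₂b') a = μ(ν₂)μ(b') a` (`moebius_mul_mul_a_eq`) and `|λ| ≤ 1`
  give the pointwise bound `SieveSequence.abs_fiS2_le`:
  `|S₂(x; y, z)| ≤ (log x) ∑_{k ≤ x} τ(k) ∑_{ν₂ ≤ Δ} |∑_{b' ≤ x/(ν₂k), y/ν₂ < b' ≤ sy/ν₂} μ(b') a_{b'ν₂k}|`
  (the printed display has `a_{ν₁ν₂bk}` for `a_{ν₂bk}` with `ν₁ ∣ k`; we bound `∑_{ν₁ ∣ k} |λ| ≤ τ(k)`).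
* (7.1): `intervalIntegral_comp_div_le` is the change of variables `u = y/ν₂` for a nonnegative
  bounded measurable integrand, `∫_Y^{eY} h(y/ν) dy/y ≤ ∫_{Y/Δ}^{eY} h(u) du/u` for `1 ≤ ν ≤ Δ`;
  `sum_card_divisors_mul_sum_le` re-indexes `ℓ = ν₂k` with `∑_{k ∣ ℓ} τ(k) = τ₃(ℓ)`
  (`divisorCountK_three_eq`).
* (B′): the range `y < b ≤ sy` (`s = 2^{k₀}` admissible, `IsFISplit`) is cut into the `k₀ ≤ 4 log x`
  dyadic pieces `(2^i u, 2^{i+1} u]` (`sum_ite_Ioc_pow_eq_sum_range`), each inside the range (B1)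
  `Δ_B⁻¹√D < N < δ⁻¹√x` for `u ∈ (Y/Δ, eY)` because `Y/Δ = Δ_B⁻¹ √D` exactly (`Δ = x^{θ/2}`,
  `Δ_B = x^θ`) and `2^{k₀-1} e Y ≤ (e/8) δ⁻¹√x`; `μ(b')a_{b'ℓ} = μ(ℓ) γ(b'; 1) μ(ℓb') a_{ℓb'}`
  (`sum_moebius_mul_a_eq`, `γ(n; 1) = 1`), `τ₃ ≤ τ₅`, and (B′) with the saving `(log x)^{-5}`
  (`reduced_bilinear_bound_pow`, `k = 5`): `SieveSequence.sum_tau3_abs_inner_le`.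
* `fi_asp_S2_estimate_holds`: Fubini for the finite sums, `∫_{Y/Δ}^{eY} du/u = 1 + log Δ ≤ 2 log x`,
  so `|S₂(x; Y, z)| ≤ (log x) · (4 log x) · (2 log x) · K A(x)(log x)^{-5} ≤ 8K A(x)(log x)^{-1}`.
  (With the printed saving `(log x)^{-3}` of (B′) the three logarithms would only give
  `S₂ ≪ A(x)`; FI's (B) carries `(log x)^{-2^{22}}`, and the Hölder step of p. 1047 delivers any
  saving up to `(log x)^{-2^{18}}`, see `…BilinearStrong`.)

## Mathlib search

Mathlib: `intervalIntegral.integral_comp_div` (change of variables), `integral_inv`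
(`∫ du/u = log`), `intervalIntegral.integral_finsetSum`, `intervalIntegral.norm_integral_le_of_norm_le`,
`intervalIntegral.integral_mono_on_of_le_Ioo`, `Nat.Coprime.sum_divisors_mul` (via the tree's
`sum_divisors_mul_of_coprime`); the tree: `…BilinearStrong` (`reduced_bilinear_bound_pow`),
`…Assembly` (`fiY_pos_and_ge`), `…Inputs` (`IsUpperSieveWeights`, `sieveRho`, `divisorCountK`).
Nothing on `S₂(x; Y, z)` itself (`lean search 'fiS2'`: only the Decomposition/Assembly files).
-/

noncomputable section

open Filter Finset
open scoped ArithmeticFunction.Moebius ArithmeticFunction.vonMangoldt ArithmeticFunction.zeta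
  ArithmeticFunction.omega ArithmeticFunction.sigma

namespace Literature.NumberTheory.Sieve

open MeasureTheory
open scoped Topology

/-! ### Sums over `bk ≤ X` -/

/-- The antidiagonals of `1 ≤ n ≤ X` tile the triangle `{(b, k) : b, k ≥ 1, bk ≤ X}`, summed by
columns: `∑_{n ≤ X} ∑_{bk = n} F(b, k) = ∑_{k ≤ X} ∑_{b ≤ X/k} F(b, k)`. [folklore] -/
theorem sum_Icc_sum_divisorsAntidiagonal_eq {M : Type*} [AddCommMonoid M] (F : ℕ × ℕ → M) (X : ℕ) :
    ∑ n ∈ Icc 1 X, ∑ p ∈ n.divisorsAntidiagonal, F p =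
      ∑ k ∈ Icc 1 X, ∑ b ∈ Icc 1 (X / k), F (b, k) := by
  classical
  set T := ((Icc 1 X) ×ˢ (Icc 1 X)).filter (fun p : ℕ × ℕ => p.1 * p.2 ≤ X) with hT
  have hdisj : ((Icc 1 X : Finset ℕ) : Set ℕ).PairwiseDisjoint Nat.divisorsAntidiagonal := by
    intro n _ m _ hnm
    refine Finset.disjoint_left.mpr fun p hp hp' => hnm ?_
    rw [Nat.mem_divisorsAntidiagonal] at hp hp'
    exact hp.1.symm.trans hp'.1
  have hunion : (Icc 1 X).biUnion Nat.divisorsAntidiagonal = T := by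
    ext ⟨b, k⟩
    simp only [Finset.mem_biUnion, Finset.mem_Icc, Nat.mem_divisorsAntidiagonal, hT,
      Finset.mem_filter, Finset.mem_product]
    constructor
    · rintro ⟨n, ⟨hn1, hnX⟩, hbk, hn0⟩
      have hb : b ≠ 0 := fun h => hn0 (by rw [← hbk, h, zero_mul])
      have hk : k ≠ 0 := fun h => hn0 (by rw [← hbk, h, mul_zero])
      have hbk' : b * k ≤ X := hbk ▸ hnX
      refine ⟨⟨⟨Nat.pos_of_ne_zero hb, ?_⟩, ⟨Nat.pos_of_ne_zero hk, ?_⟩⟩, hbk'⟩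
      · exact le_trans (Nat.le_mul_of_pos_right b (Nat.pos_of_ne_zero hk)) hbk'
      · exact le_trans (Nat.le_mul_of_pos_left k (Nat.pos_of_ne_zero hb)) hbk'
    · rintro ⟨⟨⟨hb1, -⟩, ⟨hk1, -⟩⟩, hbk⟩
      exact ⟨b * k, ⟨Nat.mul_pos hb1 hk1, hbk⟩, rfl, (Nat.mul_pos hb1 hk1).ne'⟩
  have hL : ∑ n ∈ Icc 1 X, ∑ p ∈ n.divisorsAntidiagonal, F p = ∑ p ∈ T, F p := by
    rw [← hunion, Finset.sum_biUnion hdisj]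
  have hR : ∑ k ∈ Icc 1 X, ∑ b ∈ Icc 1 (X / k), F (b, k) = ∑ p ∈ T, F p := by
    rw [hT, Finset.sum_filter, Finset.sum_product, Finset.sum_comm]
    refine Finset.sum_congr rfl fun k hk => ?_
    have hk1 : 0 < k := (Finset.mem_Icc.mp hk).1
    rw [← Finset.sum_filter]
    apply Finset.sum_congr _ (fun _ _ => rfl)
    ext b
    simp only [Finset.mem_Icc, Finset.mem_filter]
    constructor
    · rintro ⟨hb1, hbX⟩
      have := (Nat.le_div_iff_mul_le hk1).mp hbX
      exact ⟨⟨hb1, le_trans (Nat.le_mul_of_pos_right b hk1) this⟩, this⟩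
    · rintro ⟨⟨hb1, -⟩, hbk⟩
      exact ⟨hb1, (Nat.le_div_iff_mul_le hk1).mpr hbk⟩
  rw [hL, hR]

/-- **`∑_{n ≤ X} H(n) (f * g)(n) = ∑_{k ≤ X} g(k) ∑_{b ≤ X/k} f(b) H(bk)`** (FI §7: "`S₂(x; y, z) =
∑_e ∑_{y<b≤sy} ∑_{c>z} μ(b)Λ(c)ρ_{ebc} a_{ebc}`, `|S₂(x; y, z)| ≤ (log x) ∑_k |∑_{y<b≤sy} μ(b)ρ_{bk} a_{bk}|`",
the grouping `n = bk`). [cite: FriedlanderIwaniecASP1998, §7] -/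
theorem sum_Icc_mul_conv_eq (f g : ArithmeticFunction ℝ) (H : ℕ → ℝ) (X : ℕ) :
    ∑ n ∈ Icc 1 X, H n * (f * g) n =
      ∑ k ∈ Icc 1 X, g k * ∑ b ∈ Icc 1 (X / k), f b * H (b * k) := by
  have h1 : ∑ n ∈ Icc 1 X, H n * (f * g) n =
      ∑ n ∈ Icc 1 X, ∑ p ∈ n.divisorsAntidiagonal, H (p.1 * p.2) * (f p.1 * g p.2) := by
    refine Finset.sum_congr rfl fun n _ => ?_
    rw [ArithmeticFunction.mul_apply, Finset.mul_sum]
    refine Finset.sum_congr rfl fun p hp => ?_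
    rw [(Nat.mem_divisorsAntidiagonal.mp hp).1]
  rw [h1, sum_Icc_sum_divisorsAntidiagonal_eq (fun p : ℕ × ℕ => H (p.1 * p.2) * (f p.1 * g p.2)) X]
  refine Finset.sum_congr rfl fun k _ => ?_
  rw [Finset.mul_sum]
  exact Finset.sum_congr rfl fun b _ => by ring

/-! ### Expanding `ρ_{bk}` and substituting `b = ν₂ b'` (FI §7) -/

/-- `ρ(bk) = ∑_{ν₁ ∣ k} ∑_{ν₂ ∣ b} λ_{ν₁ν₂}` for squarefree `bk` (FI §7: `ρ_{bk} = ∑ λ_{ν₁ν₂}`).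
[cite: FriedlanderIwaniecASP1998, §7] -/
theorem sieveRho_mul_of_squarefree (lam : ℕ → ℤ) {b k : ℕ} (h : Squarefree (b * k)) :
    (sieveRho lam (b * k) : ℝ) = ∑ ν₁ ∈ k.divisors, ∑ ν₂ ∈ b.divisors, (lam (ν₁ * ν₂) : ℝ) := by
  rw [sieveRho, Int.cast_sum, mul_comm b k]
  rw [mul_comm] at h
  exact sum_divisors_mul_of_coprime (Nat.coprime_of_squarefree_mul h) (fun d => (lam d : ℝ))

variable {A : SieveSequence}

/-- `μ(ν₂ b') a_{ν₂ b' k} = μ(ν₂) μ(b') a_{ν₂ b' k}` under (1.16) (if `(ν₂, b') > 1` both sides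
vanish). [cite: FriedlanderIwaniecASP1998, (1.16)] -/
theorem moebius_mul_mul_a_eq (h116 : ∀ n : ℕ, ¬Squarefree n → A.a n = 0) (ν₂ b' k : ℕ) :
    (μ (ν₂ * b') : ℝ) * A.a (ν₂ * b' * k) = (μ ν₂ : ℝ) * (μ b' : ℝ) * A.a (ν₂ * b' * k) := by
  by_cases hsq : Squarefree (ν₂ * b')
  · rw [ArithmeticFunction.isMultiplicative_moebius.map_mul_of_coprime
      (Nat.coprime_of_squarefree_mul hsq), Int.cast_mul]
  · have : ¬Squarefree (ν₂ * b' * k) := fun h' => hsq (Squarefree.of_mul_left h')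
    rw [h116 _ this, mul_zero, mul_zero]

/-- **The inner sums of `S₂` after expanding `ρ` and substituting `b = ν₂ b'`** (FI §7:
"`|S₂(x; y, z)| ≤ (log x) ∑_k |∑_{y<b≤sy} μ(b)ρ_{bk} a_{bk}| ≤ (log x) ∑_{ν₁}∑_{ν₂} |λ_{ν₁ν₂}| ∑_k
|∑_{y/ν₂ < b ≤ sy/ν₂} μ(b) a_{ν₁ν₂bk}|`" [sic: `a_{ν₂bk}`, `ν₁ ∣ k`]): for weights of level `L ≥ 0`,
`k ≥ 1`, `y ≥ 0` and any `s`,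
`|∑_{b ≤ X/k} μ(y < b ≤ sy) a_{bk} ρ_{bk}| ≤ ∑_{ν₁ ∣ k} ∑_{ν₂ ≤ L} |∑_{b' ≤ X/(ν₂k), y/ν₂ < b' ≤ s y/ν₂}
μ(b') a_{b'ν₂k}|`. [cite: FriedlanderIwaniecASP1998, §7] -/
theorem abs_inner_S2_le (A : SieveSequence) (h116 : ∀ n : ℕ, ¬Squarefree n → A.a n = 0)
    {P L : ℝ} {lam : ℕ → ℤ} (hw : IsUpperSieveWeights P L lam) (hL : 0 ≤ L)
    (k X : ℕ) (y s : ℝ) :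
    |∑ b ∈ Icc 1 (X / k), truncIoc (μ : ArithmeticFunction ℝ) y (s * y) b *
        (A.a (b * k) * (sieveRho lam (b * k) : ℝ))| ≤
      (k.divisors.card : ℝ) * ∑ ν₂ ∈ Icc 1 ⌊L⌋₊,
        |∑ b ∈ Icc 1 (X / (ν₂ * k)),
          (if y / ν₂ < (b : ℝ) ∧ (b : ℝ) ≤ s * (y / ν₂) then (μ b : ℝ) * A.a (b * (ν₂ * k)) else 0)| := by
  classical
  set B := X / k with hB
  set Ψ : ℕ → ℝ := fun ν₂ => ∑ b ∈ Icc 1 (X / (ν₂ * k)),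
      (if y / ν₂ < (b : ℝ) ∧ (b : ℝ) ≤ s * (y / ν₂) then (μ b : ℝ) * A.a (b * (ν₂ * k)) else 0)
    with hΨ
  -- Step 1: expand `ρ`
  have h1 : ∀ b ∈ Icc 1 B, truncIoc (μ : ArithmeticFunction ℝ) y (s * y) b *
      (A.a (b * k) * (sieveRho lam (b * k) : ℝ)) =
      ∑ ν₁ ∈ k.divisors, ∑ ν₂ ∈ b.divisors,
        (lam (ν₁ * ν₂) : ℝ) * (truncIoc (μ : ArithmeticFunction ℝ) y (s * y) b * A.a (b * k)) := by
    intro b _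
    by_cases hsq : Squarefree (b * k)
    · rw [sieveRho_mul_of_squarefree lam hsq, Finset.mul_sum, Finset.mul_sum]
      refine Finset.sum_congr rfl fun ν₁ _ => ?_
      rw [Finset.mul_sum, Finset.mul_sum]
      exact Finset.sum_congr rfl fun ν₂ _ => by ring
    · rw [h116 _ hsq]
      simp
  -- Step 2: swap the sums
  have h2 : ∑ b ∈ Icc 1 B, ∑ ν₁ ∈ k.divisors, ∑ ν₂ ∈ b.divisors,
        (lam (ν₁ * ν₂) : ℝ) * (truncIoc (μ : ArithmeticFunction ℝ) y (s * y) b * A.a (b * k)) =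
      ∑ ν₁ ∈ k.divisors, ∑ ν₂ ∈ Icc 1 B, ∑ b ∈ (Icc 1 B).filter (ν₂ ∣ ·),
        (lam (ν₁ * ν₂) : ℝ) * (truncIoc (μ : ArithmeticFunction ℝ) y (s * y) b * A.a (b * k)) := by
    rw [Finset.sum_comm]
    refine Finset.sum_congr rfl fun ν₁ _ => ?_
    refine Finset.sum_comm' fun b ν₂ => ?_
    simp only [Finset.mem_Icc, Nat.mem_divisors, Finset.mem_filter]
    constructor
    · rintro ⟨⟨hb1, hbB⟩, hν₂b, -⟩
      exact ⟨⟨⟨hb1, hbB⟩, hν₂b⟩, Nat.pos_of_dvd_of_pos hν₂b hb1, (Nat.le_of_dvd hb1 hν₂b).trans hbB⟩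
    · rintro ⟨⟨⟨hb1, hbB⟩, hν₂b⟩, -, -⟩
      exact ⟨⟨hb1, hbB⟩, hν₂b, by omega⟩
  -- Step 3: `b = ν₂ b'`
  have h3 : ∀ ν₁ ∈ k.divisors, ∀ ν₂ ∈ Icc 1 B,
      ∑ b ∈ (Icc 1 B).filter (ν₂ ∣ ·),
        (lam (ν₁ * ν₂) : ℝ) * (truncIoc (μ : ArithmeticFunction ℝ) y (s * y) b * A.a (b * k)) =
      (lam (ν₁ * ν₂) : ℝ) * (μ ν₂ : ℝ) * Ψ ν₂ := by
    intro ν₁ _ ν₂ hν₂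
    have hν₂0 : 0 < ν₂ := (Finset.mem_Icc.mp hν₂).1
    have hνr : (0 : ℝ) < ν₂ := by exact_mod_cast hν₂0
    have himg : (Icc 1 B).filter (ν₂ ∣ ·) = (Icc 1 (B / ν₂)).image (fun b' => ν₂ * b') := by
      ext b
      simp only [Finset.mem_filter, Finset.mem_Icc, Finset.mem_image]
      constructor
      · rintro ⟨⟨hb1, hbB⟩, ⟨b', rfl⟩⟩
        refine ⟨b', ⟨?_, ?_⟩, rfl⟩
        · exact Nat.pos_of_mul_pos_left hb1
        · exact (Nat.le_div_iff_mul_le hν₂0).mpr (by rwa [mul_comm] at hbB)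
      · rintro ⟨b', ⟨hb'1, hb'B⟩, rfl⟩
        refine ⟨⟨Nat.mul_pos hν₂0 hb'1, ?_⟩, dvd_mul_right _ _⟩
        have := (Nat.le_div_iff_mul_le hν₂0).mp hb'B
        rwa [mul_comm]
    rw [himg, Finset.sum_image (fun b₁ _ b₂ _ h => Nat.eq_of_mul_eq_mul_left hν₂0 h)]
    have hBν : X / (ν₂ * k) = B / ν₂ := by rw [hB, Nat.div_div_eq_div_mul, mul_comm]
    simp only [hΨ, hBν, Finset.mul_sum]
    refine Finset.sum_congr rfl fun b' _ => ?_
    rw [truncIoc_apply, ArithmeticFunction.intCoe_apply]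
    have hcond : (y < ((ν₂ * b' : ℕ) : ℝ) ∧ ((ν₂ * b' : ℕ) : ℝ) ≤ s * y) ↔
        (y / ν₂ < (b' : ℝ) ∧ (b' : ℝ) ≤ s * (y / ν₂)) := by
      push_cast
      rw [div_lt_iff₀ hνr, show s * (y / ν₂) = s * y / ν₂ by ring, le_div_iff₀ hνr]
      constructor
      · rintro ⟨h1, h2⟩; exact ⟨by linarith [mul_comm (ν₂ : ℝ) b'], by linarith [mul_comm (ν₂ : ℝ) b']⟩
      · rintro ⟨h1, h2⟩; exact ⟨by linarith [mul_comm (ν₂ : ℝ) b'], by linarith [mul_comm (ν₂ : ℝ) b']⟩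
    by_cases hc : y < ((ν₂ * b' : ℕ) : ℝ) ∧ ((ν₂ * b' : ℕ) : ℝ) ≤ s * y
    · rw [if_pos hc, if_pos (hcond.mp hc), show b' * (ν₂ * k) = ν₂ * b' * k by ring,
        moebius_mul_mul_a_eq h116]
      ring
    · rw [if_neg hc, if_neg (fun h => hc (hcond.mpr h))]
      ring
  have h4 : ∑ b ∈ Icc 1 B, truncIoc (μ : ArithmeticFunction ℝ) y (s * y) b *
      (A.a (b * k) * (sieveRho lam (b * k) : ℝ)) =
      ∑ ν₁ ∈ k.divisors, ∑ ν₂ ∈ Icc 1 B, (lam (ν₁ * ν₂) : ℝ) * (μ ν₂ : ℝ) * Ψ ν₂ := by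
    rw [Finset.sum_congr rfl h1, h2]
    exact Finset.sum_congr rfl fun ν₁ hν₁ => Finset.sum_congr rfl fun ν₂ hν₂ => h3 ν₁ hν₁ ν₂ hν₂
  rw [h4]
  have hν₁b : ∀ ν₁ ∈ k.divisors, |∑ ν₂ ∈ Icc 1 B, (lam (ν₁ * ν₂) : ℝ) * (μ ν₂ : ℝ) * Ψ ν₂| ≤
      ∑ ν₂ ∈ Icc 1 ⌊L⌋₊, |Ψ ν₂| := by
    intro ν₁ hν₁
    have hν₁1 : 1 ≤ ν₁ := Nat.pos_of_mem_divisors hν₁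
    refine (Finset.abs_sum_le_sum_abs _ _).trans ?_
    have hterm : ∀ ν₂ ∈ Icc 1 B, |(lam (ν₁ * ν₂) : ℝ) * (μ ν₂ : ℝ) * Ψ ν₂| ≤
        if ν₂ ≤ ⌊L⌋₊ then |Ψ ν₂| else 0 := by
      intro ν₂ hν₂
      split_ifs with hle
      · rw [abs_mul, abs_mul]
        have hl : |(lam (ν₁ * ν₂) : ℝ)| ≤ 1 := by exact_mod_cast hw.abs_le_one _
        have hμ : |(μ ν₂ : ℝ)| ≤ 1 := by exact_mod_cast ArithmeticFunction.abs_moebius_le_one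
        calc |(lam (ν₁ * ν₂) : ℝ)| * |(μ ν₂ : ℝ)| * |Ψ ν₂| ≤ 1 * 1 * |Ψ ν₂| := by
              gcongr
          _ = |Ψ ν₂| := by ring
      · have hLν : L < ((ν₁ * ν₂ : ℕ) : ℝ) := by
          have h1 : ⌊L⌋₊ < ν₂ := not_le.mp hle
          have h2 : L < (ν₂ : ℝ) := (Nat.floor_lt hL).mp h1
          calc L < (ν₂ : ℝ) := h2
            _ ≤ ((ν₁ * ν₂ : ℕ) : ℝ) := by exact_mod_cast Nat.le_mul_of_pos_left ν₂ hν₁1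
        rw [hw.eq_zero_of_lt hLν, Int.cast_zero, zero_mul, zero_mul, abs_zero]
    calc ∑ ν₂ ∈ Icc 1 B, |(lam (ν₁ * ν₂) : ℝ) * (μ ν₂ : ℝ) * Ψ ν₂|
        ≤ ∑ ν₂ ∈ Icc 1 B, (if ν₂ ≤ ⌊L⌋₊ then |Ψ ν₂| else 0) := Finset.sum_le_sum hterm
      _ = ∑ ν₂ ∈ (Icc 1 B).filter (· ≤ ⌊L⌋₊), |Ψ ν₂| := (Finset.sum_filter _ _).symm
      _ ≤ ∑ ν₂ ∈ Icc 1 ⌊L⌋₊, |Ψ ν₂| := by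
          refine Finset.sum_le_sum_of_subset_of_nonneg (fun ν₂ hν₂ => ?_) fun _ _ _ => abs_nonneg _
          obtain ⟨h1, h2⟩ := Finset.mem_filter.mp hν₂
          exact Finset.mem_Icc.mpr ⟨(Finset.mem_Icc.mp h1).1, h2⟩

  calc |∑ ν₁ ∈ k.divisors, ∑ ν₂ ∈ Icc 1 B, (lam (ν₁ * ν₂) : ℝ) * (μ ν₂ : ℝ) * Ψ ν₂|
      ≤ ∑ ν₁ ∈ k.divisors, |∑ ν₂ ∈ Icc 1 B, (lam (ν₁ * ν₂) : ℝ) * (μ ν₂ : ℝ) * Ψ ν₂| :=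
        Finset.abs_sum_le_sum_abs _ _
    _ ≤ ∑ ν₁ ∈ k.divisors, ∑ ν₂ ∈ Icc 1 ⌊L⌋₊, |Ψ ν₂| := Finset.sum_le_sum hν₁b
    _ = (k.divisors.card : ℝ) * ∑ ν₂ ∈ Icc 1 ⌊L⌋₊, |Ψ ν₂| := by
        rw [Finset.sum_const, nsmul_eq_mul]


/-! ### The pointwise bound for `S₂(x; y, z)` -/

/-- `0 ≤ ∑_{c ∣ k} Λ(c > z) ≤ log k`. [folklore] -/
theorem truncGT_vonMangoldt_mul_zeta_bounds (z : ℝ) (k : ℕ) :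
    0 ≤ (truncGT Λ z * ζ) k ∧ (truncGT Λ z * ζ) k ≤ Real.log k := by
  rw [ArithmeticFunction.coe_mul_zeta_apply]
  have hle : ∀ c ∈ k.divisors, truncGT Λ z c ≤ Λ c := fun c _ => by
    rw [truncGT_apply]
    split_ifs
    · exact le_rfl
    · exact ArithmeticFunction.vonMangoldt_nonneg
  have h0 : ∀ c ∈ k.divisors, 0 ≤ truncGT Λ z c := fun c _ => by
    rw [truncGT_apply]
    split_ifs
    · exact ArithmeticFunction.vonMangoldt_nonneg
    · exact le_rfl
  refine ⟨Finset.sum_nonneg h0, ?_⟩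
  calc ∑ c ∈ k.divisors, truncGT Λ z c ≤ ∑ c ∈ k.divisors, Λ c := Finset.sum_le_sum hle
    _ = Real.log k := ArithmeticFunction.vonMangoldt_sum

/-- **The pointwise bound for `S₂`** (FI §7, first two displays and the expansion of `ρ`):
for weights of level `L ≥ 0`, (1.16), `x ≥ 1` and all `y, z, s`,
`|S₂(x; y, z)| ≤ (log x) ∑_{k ≤ x} τ(k) ∑_{ν₂ ≤ L} |∑_{b' ≤ x/(ν₂k), y/ν₂ < b' ≤ sy/ν₂} μ(b') a_{b'ν₂k}|`.
[cite: FriedlanderIwaniecASP1998, §7] -/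
theorem SieveSequence.abs_fiS2_le (A : SieveSequence) (h116 : ∀ n : ℕ, ¬Squarefree n → A.a n = 0)
    {P L : ℝ} {lam : ℕ → ℤ} (hw : IsUpperSieveWeights P L lam) (hL : 0 ≤ L) {x : ℝ} (hx : 1 ≤ x)
    (s y z : ℝ) :
    |A.fiS2 lam s x y z| ≤ Real.log x * ∑ k ∈ Icc 1 ⌊x⌋₊, (k.divisors.card : ℝ) *
      ∑ ν₂ ∈ Icc 1 ⌊L⌋₊, |∑ b ∈ Icc 1 (⌊x⌋₊ / (ν₂ * k)),
        (if y / ν₂ < (b : ℝ) ∧ (b : ℝ) ≤ s * (y / ν₂) then (μ b : ℝ) * A.a (b * (ν₂ * k)) else 0)| := by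
  rw [SieveSequence.fiS2, SieveSequence.rhoSum, mul_assoc (truncIoc (μ : ArithmeticFunction ℝ) y (s * y)),
    sum_Icc_mul_conv_eq (truncIoc (μ : ArithmeticFunction ℝ) y (s * y)) (truncGT Λ z * ζ)
      (fun n => A.a n * (sieveRho lam n : ℝ)) ⌊x⌋₊, Finset.mul_sum]
  refine (Finset.abs_sum_le_sum_abs _ _).trans (Finset.sum_le_sum fun k hk => ?_)
  obtain ⟨hk1, hkx⟩ := Finset.mem_Icc.mp hk
  obtain ⟨hG0, hGle⟩ := truncGT_vonMangoldt_mul_zeta_bounds z k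
  have hlogk : Real.log k ≤ Real.log x :=
    Real.log_le_log (by exact_mod_cast hk1) ((Nat.cast_le.mpr hkx).trans (Nat.floor_le (by linarith)))
  rw [abs_mul, abs_of_nonneg hG0]
  exact mul_le_mul (hGle.trans hlogk) (abs_inner_S2_le A h116 hw hL k ⌊x⌋₊ y s) (abs_nonneg _)
    (Real.log_nonneg hx)

/-! ### The inner sums as functions of `u`: measurability, bounds, change of variables -/

/-- `u ↦ ∑_{b ≤ X/ℓ, u < b ≤ su} μ(b) a_{bℓ}` is measurable. [folklore] -/
theorem SieveSequence.measurable_innerS2 (A : SieveSequence) (X ℓ : ℕ) (s : ℝ) :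
    Measurable fun u : ℝ => ∑ b ∈ Icc 1 (X / ℓ),
      (if u < (b : ℝ) ∧ (b : ℝ) ≤ s * u then (μ b : ℝ) * A.a (b * ℓ) else 0) := by
  refine Finset.measurable_sum _ fun b _ => ?_
  refine Measurable.ite ?_ measurable_const measurable_const
  exact (measurableSet_lt measurable_id measurable_const).inter
    (measurableSet_le measurable_const (measurable_id.const_mul s))

/-- `|∑_{b ≤ X/ℓ, u < b ≤ su} μ(b) a_{bℓ}| ≤ ∑_{b ≤ X/ℓ} a_{bℓ}`. [folklore] -/
theorem SieveSequence.abs_innerS2_le (A : SieveSequence) (X ℓ : ℕ) (s u : ℝ) :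
    |∑ b ∈ Icc 1 (X / ℓ), (if u < (b : ℝ) ∧ (b : ℝ) ≤ s * u then (μ b : ℝ) * A.a (b * ℓ) else 0)| ≤
      ∑ b ∈ Icc 1 (X / ℓ), A.a (b * ℓ) := by
  refine (Finset.abs_sum_le_sum_abs _ _).trans (Finset.sum_le_sum fun b _ => ?_)
  split_ifs
  · rw [abs_mul, abs_of_nonneg (A.a_nonneg _)]
    have hμ : |(μ b : ℝ)| ≤ 1 := by exact_mod_cast ArithmeticFunction.abs_moebius_le_one
    calc |(μ b : ℝ)| * A.a (b * ℓ) ≤ 1 * A.a (b * ℓ) :=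
          mul_le_mul_of_nonneg_right hμ (A.a_nonneg _)
      _ = A.a (b * ℓ) := one_mul _
  · rw [abs_zero]; exact A.a_nonneg _

/-- A measurable function bounded on `Ι a b` is interval integrable. [folklore] -/
theorem intervalIntegrable_of_abs_le {f : ℝ → ℝ} (hf : Measurable f) {a b M : ℝ}
    (hM : ∀ t ∈ Set.uIoc a b, |f t| ≤ M) : IntervalIntegrable f volume a b := by
  refine (intervalIntegrable_const (c := M)).mono_fun' hf.aestronglyMeasurable ?_
  rw [Filter.EventuallyLE, ae_restrict_iff' measurableSet_uIoc]
  exact Filter.Eventually.of_forall fun t ht => by simpa [Real.norm_eq_abs] using hM t ht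

/-- **Removing `ν₂` by the integration over `y`** (FI §7, (7.1): "In order to remove `ν₂` from the
range of the inner summation we take advantage of the integration over `y`":
`∫_Y^{eY} |F(y/ν₂)| dy/y = ∫_{Y/ν₂}^{eY/ν₂} |F(u)| du/u ≤ ∫_{Y/Δ}^{eY} |F(u)| du/u` for `1 ≤ ν₂ ≤ Δ`),
for a nonnegative bounded measurable `h` in place of `|F|`. [cite: FriedlanderIwaniecASP1998, §7 (7.1)] -/
theorem intervalIntegral_comp_div_le {h : ℝ → ℝ} (hm : Measurable h) (h0 : ∀ u, 0 ≤ h u) {M : ℝ}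
    (hM : ∀ u, h u ≤ M) {Y L ν : ℝ} (hY : 0 < Y) (hν : 1 ≤ ν) (hνL : ν ≤ L) :
    ∫ y in Y..(Real.exp 1 * Y), h (y / ν) / y ≤ ∫ u in (Y / L)..(Real.exp 1 * Y), h u / u := by
  have hν0 : 0 < ν := by linarith
  have hL0 : 0 < L := by linarith
  have he1 : (1 : ℝ) ≤ Real.exp 1 := by linarith [Real.add_one_le_exp (1 : ℝ)]
  have hM0 : 0 ≤ M := (h0 0).trans (hM 0)
  -- change of variables `u = y/ν`
  have hcv : ∫ y in Y..(Real.exp 1 * Y), h (y / ν) / y =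
      ∫ u in (Y / ν)..(Real.exp 1 * Y / ν), h u / u := by
    have hfun : (fun y : ℝ => h (y / ν) / y) = fun y => ν⁻¹ * ((fun u : ℝ => h u / u) (y / ν)) := by
      ext y
      simp only
      rw [div_div_eq_mul_div, mul_div_assoc', mul_comm (h (y / ν)) ν, inv_mul_cancel_left₀ hν0.ne']
    rw [hfun, intervalIntegral.integral_const_mul,
      intervalIntegral.integral_comp_div (fun u : ℝ => h u / u) hν0.ne', smul_eq_mul,
      inv_mul_cancel_left₀ hν0.ne']
  rw [hcv]
  have hca : Y / L ≤ Y / ν := div_le_div_of_nonneg_left hY.le hν0 hνL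
  have hab : Y / ν ≤ Real.exp 1 * Y / ν :=
    div_le_div_of_nonneg_right (le_mul_of_one_le_left hY.le he1) hν0.le
  have hbd : Real.exp 1 * Y / ν ≤ Real.exp 1 * Y := div_le_self (by positivity) hν
  have hYL : 0 < Y / L := div_pos hY hL0
  refine intervalIntegral.integral_mono_interval hca hab hbd ?_ ?_
  · refine MeasureTheory.ae_restrict_of_forall_mem measurableSet_Ioc fun u hu => ?_
    exact div_nonneg (h0 u) (hYL.le.trans hu.1.le)
  · refine intervalIntegrable_of_abs_le (f := fun u : ℝ => h u / u)
      (hm.div measurable_id : Measurable fun u : ℝ => h u / u) (M := M / (Y / L)) fun u hu => ?_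
    rw [Set.uIoc_of_le (hca.trans (hab.trans hbd))] at hu
    have hu0 : 0 < u := hYL.trans hu.1
    rw [abs_of_nonneg (div_nonneg (h0 u) hu0.le)]
    calc h u / u ≤ M / u := div_le_div_of_nonneg_right (hM u) hu0.le
      _ ≤ M / (Y / L) := div_le_div_of_nonneg_left hM0 hYL hu.1.le

/-! ### Reindexing `ℓ = ν₂ k` (FI §7: the weight `τ₃(ℓ)`) -/

/-- `τ₃(ℓ) = ∑_{k ∣ ℓ} τ(k)`. [folklore] -/
theorem divisorCountK_three_eq (ℓ : ℕ) :
    (divisorCountK 3 ℓ : ℝ) = ∑ k ∈ ℓ.divisors, (k.divisors.card : ℝ) := by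
  rw [show (3 : ℕ) = 2 + 1 from rfl, divisorCountK_succ_apply, Nat.cast_sum]
  refine Finset.sum_congr rfl fun k _ => ?_
  rw [divisorCountK_two, ArithmeticFunction.sigma_zero_apply]

/-- **Reindexing by `ℓ = ν₂ k`** (FI §7: "`≤ (log x) ∫ ∑_ℓ τ₃(ℓ) |∑_{y<b≤sy} μ(b) a_{bℓ}| dy/y`"): for
`J ≥ 0` vanishing beyond `X`, `∑_{k ≤ X} τ(k) ∑_{ν₂ ≤ N} J(ν₂k) ≤ ∑_{ℓ ≤ X} τ₃(ℓ) J(ℓ)`.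
[cite: FriedlanderIwaniecASP1998, §7 (7.1)] -/
theorem sum_card_divisors_mul_sum_le {J : ℕ → ℝ} (hJ0 : ∀ ℓ, 0 ≤ J ℓ) {X : ℕ}
    (hJX : ∀ ℓ, X < ℓ → J ℓ = 0) (N : ℕ) :
    ∑ k ∈ Icc 1 X, (k.divisors.card : ℝ) * ∑ ν ∈ Icc 1 N, J (ν * k) ≤
      ∑ ℓ ∈ Icc 1 X, (divisorCountK 3 ℓ : ℝ) * J ℓ := by
  classical
  set Box := (Icc 1 X) ×ˢ (Icc 1 N) with hBox
  set S := Box.filter (fun p : ℕ × ℕ => p.2 * p.1 ≤ X) with hS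
  have h1 : ∑ k ∈ Icc 1 X, (k.divisors.card : ℝ) * ∑ ν ∈ Icc 1 N, J (ν * k) =
      ∑ p ∈ Box, (p.1.divisors.card : ℝ) * J (p.2 * p.1) := by
    rw [hBox, Finset.sum_product]
    exact Finset.sum_congr rfl fun k _ => by rw [Finset.mul_sum]
  have h2 : ∑ p ∈ Box, (p.1.divisors.card : ℝ) * J (p.2 * p.1) =
      ∑ p ∈ S, (p.1.divisors.card : ℝ) * J (p.2 * p.1) := by
    rw [hS, Finset.sum_filter_of_ne]
    intro p _ hne
    by_contra hle
    exact hne (by rw [hJX _ (not_le.mp hle), mul_zero])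
  have hmaps : ∀ p ∈ S, p.2 * p.1 ∈ Icc 1 X := by
    rintro ⟨k, ν⟩ hp
    obtain ⟨hpB, hle⟩ := Finset.mem_filter.mp hp
    obtain ⟨hk, hν⟩ := Finset.mem_product.mp hpB
    exact Finset.mem_Icc.mpr ⟨Nat.mul_pos (Finset.mem_Icc.mp hν).1 (Finset.mem_Icc.mp hk).1, hle⟩
  rw [h1, h2, ← Finset.sum_fiberwise_of_maps_to hmaps]
  refine Finset.sum_le_sum fun ℓ hℓ => ?_
  have hℓ0 : ℓ ≠ 0 := by have := (Finset.mem_Icc.mp hℓ).1; omega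
  set Fib := S.filter (fun p : ℕ × ℕ => p.2 * p.1 = ℓ) with hFib
  have h3 : ∑ p ∈ Fib, (p.1.divisors.card : ℝ) * J (p.2 * p.1) =
      (∑ p ∈ Fib, (p.1.divisors.card : ℝ)) * J ℓ := by
    rw [Finset.sum_mul]
    refine Finset.sum_congr rfl fun p hp => ?_
    rw [(Finset.mem_filter.mp hp).2]
  rw [h3]
  refine mul_le_mul_of_nonneg_right ?_ (hJ0 ℓ)
  -- `p ↦ p.1` is injective on the fiber and lands in the divisors of `ℓ`
  have hinj : Set.InjOn (fun p : ℕ × ℕ => p.1) ↑Fib := by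
    rintro ⟨k, ν⟩ hp ⟨k', ν'⟩ hp' (hkk : k = k')
    simp only [hFib, Finset.coe_filter, Set.mem_setOf_eq] at hp hp'
    subst hkk
    have hk0 : 0 < k := (Finset.mem_Icc.mp (Finset.mem_product.mp (Finset.mem_filter.mp hp.1).1).1).1
    have : ν = ν' := Nat.eq_of_mul_eq_mul_right hk0 (hp.2.trans hp'.2.symm)
    rw [this]
  rw [← Finset.sum_image (f := fun k : ℕ => (k.divisors.card : ℝ)) hinj, divisorCountK_three_eq]
  refine Finset.sum_le_sum_of_subset_of_nonneg (fun k hk => ?_) fun _ _ _ => Nat.cast_nonneg _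
  obtain ⟨⟨k', ν⟩, hp, rfl⟩ := Finset.mem_image.mp hk
  obtain ⟨-, hpl⟩ := Finset.mem_filter.mp hp
  exact Nat.mem_divisors.mpr ⟨⟨ν, by rw [← hpl, mul_comm]⟩, hℓ0⟩


/-! ### Dyadic pieces and the bilinear bound (B′) (FI §7: "By (B′) we conclude (7.2)") -/

/-- **Dyadic decomposition of `(u, su]`, `s = 2^{k₀}`**: for `u, x ≥ 0`, `ℓ ≥ 1`,
`∑_{b ≤ x/ℓ, u < b ≤ 2^{k₀}u} c(b) = ∑_{i<k₀} ∑_{2^i u < n ≤ 2^{i+1}u, ℓn ≤ x} c(n)`, the pieces in the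
form of hypothesis (B). [cite: FriedlanderIwaniecASP1998, §7] -/
theorem sum_ite_Ioc_pow_eq_sum_range (c : ℕ → ℝ) {u : ℝ} (hu : 0 ≤ u) (k₀ : ℕ) {x : ℝ} (hx : 0 ≤ x)
    {ℓ : ℕ} (hℓ : 1 ≤ ℓ) :
    ∑ b ∈ Icc 1 (⌊x⌋₊ / ℓ), (if u < (b : ℝ) ∧ (b : ℝ) ≤ 2 ^ k₀ * u then c b else 0) =
      ∑ i ∈ range k₀, ∑ n ∈ (Ioc ⌊2 ^ i * u⌋₊ ⌊2 * (2 ^ i * u)⌋₊).filter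
        (fun n : ℕ => ((ℓ * n : ℕ) : ℝ) ≤ x), c n := by
  induction k₀ with
  | zero =>
    rw [Finset.sum_range_zero]
    refine Finset.sum_eq_zero fun b _ => ?_
    rw [if_neg]
    rintro ⟨h1, h2⟩
    rw [pow_zero, one_mul] at h2
    linarith
  | succ k ih =>
    rw [Finset.sum_range_succ, ← ih]
    have hN0 : 0 ≤ 2 ^ k * u := by positivity
    have huN : u ≤ 2 ^ k * u := le_mul_of_one_le_left hu (one_le_pow₀ one_le_two)
    have hsplit : ∀ b : ℕ, (if u < (b : ℝ) ∧ (b : ℝ) ≤ 2 ^ (k + 1) * u then c b else 0) =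
        (if u < (b : ℝ) ∧ (b : ℝ) ≤ 2 ^ k * u then c b else 0) +
        (if 2 ^ k * u < (b : ℝ) ∧ (b : ℝ) ≤ 2 * (2 ^ k * u) then c b else 0) := by
      intro b
      have h2 : (2 : ℝ) ^ (k + 1) * u = 2 * (2 ^ k * u) := by rw [pow_succ]; ring
      rw [h2]
      by_cases hb1 : u < (b : ℝ)
      · by_cases hb2 : (b : ℝ) ≤ 2 ^ k * u
        · rw [if_pos ⟨hb1, by linarith⟩, if_pos ⟨hb1, hb2⟩, if_neg (fun h => absurd hb2 (not_le.mpr h.1)),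
            add_zero]
        · push Not at hb2
          by_cases hb3 : (b : ℝ) ≤ 2 * (2 ^ k * u)
          · rw [if_pos ⟨hb1, hb3⟩, if_neg (fun h => absurd h.2 (not_le.mpr hb2)), if_pos ⟨hb2, hb3⟩,
              zero_add]
          · rw [if_neg (fun h => hb3 h.2), if_neg (fun h => absurd h.2 (not_le.mpr hb2)),
              if_neg (fun h => hb3 h.2), add_zero]
      · rw [if_neg (fun h => hb1 h.1), if_neg (fun h => hb1 h.1), if_neg (fun h => hb1 (by linarith [h.1])),
          add_zero]
    rw [Finset.sum_congr rfl fun b _ => hsplit b, Finset.sum_add_distrib]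
    congr 1
    rw [← Finset.sum_filter]
    apply Finset.sum_congr _ (fun _ _ => rfl)
    ext b
    simp only [Finset.mem_filter, Finset.mem_Icc, Finset.mem_Ioc]
    have h2N0 : 0 ≤ 2 * (2 ^ k * u) := by positivity
    constructor
    · rintro ⟨⟨hb1, hbx⟩, hNb, hb2N⟩
      refine ⟨⟨(Nat.floor_lt hN0).mpr hNb, (Nat.le_floor_iff h2N0).mpr hb2N⟩, ?_⟩
      have h1 : b * ℓ ≤ ⌊x⌋₊ := (Nat.le_div_iff_mul_le hℓ).mp hbx
      have h2 : ((b * ℓ : ℕ) : ℝ) ≤ x := (Nat.cast_le.mpr h1).trans (Nat.floor_le hx)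
      rwa [mul_comm] at h2
    · rintro ⟨⟨hNb, hb2N⟩, hℓb⟩
      have hNb' : 2 ^ k * u < (b : ℝ) := (Nat.floor_lt hN0).mp hNb
      have hb0 : 0 < b := by
        have : (0 : ℝ) < b := lt_of_le_of_lt hN0 hNb'
        exact_mod_cast this
      refine ⟨⟨hb0, ?_⟩, hNb', (Nat.le_floor_iff h2N0).mp hb2N⟩
      refine (Nat.le_div_iff_mul_le hℓ).mpr (Nat.le_floor ?_)
      rw [mul_comm] at hℓb
      exact_mod_cast hℓb

variable {A : SieveSequence} in
/-- **From `μ(b') a_{b'ℓ}` to the form `γ(n; 1) μ(ℓn) a_{ℓn}` of (B)**: `μ(n) a_{nℓ} = μ(ℓ) · γ(n;1)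
μ(ℓn) a_{ℓn}` for `n ≥ 1` under (1.16) (`γ(n; 1) = 1`; if `ℓn` is not squarefree both sides vanish,
otherwise `μ(ℓn) = μ(ℓ)μ(n)` and `μ(ℓ)² = 1`). [cite: FriedlanderIwaniecASP1998, §7] -/
theorem sum_moebius_mul_a_eq (h116 : ∀ n : ℕ, ¬Squarefree n → A.a n = 0) (ℓ : ℕ) (S : Finset ℕ)
    (hS : ∀ n ∈ S, n ≠ 0) :
    ∑ n ∈ S, (μ n : ℝ) * A.a (n * ℓ) =
      (μ ℓ : ℝ) * ∑ n ∈ S, (SieveSequence.fiGamma 1 n : ℝ) * (μ (ℓ * n) : ℝ) * A.a (ℓ * n) := by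
  rw [Finset.mul_sum]
  refine Finset.sum_congr rfl fun n hn => ?_
  rw [SieveSequence.fiGamma_one (hS n hn), Int.cast_one, one_mul, mul_comm n ℓ]
  by_cases hsq : Squarefree (ℓ * n)
  · have hcop := Nat.coprime_of_squarefree_mul hsq
    have hℓ : Squarefree ℓ := Squarefree.of_mul_left hsq
    have hμℓ : (μ ℓ : ℝ) * (μ ℓ : ℝ) = 1 := by
      rw [ArithmeticFunction.moebius_apply_of_squarefree hℓ]
      push_cast
      rw [← pow_add, ← two_mul, pow_mul]
      norm_num
    rw [ArithmeticFunction.isMultiplicative_moebius.map_mul_of_coprime hcop, Int.cast_mul, ← mul_assoc,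
      ← mul_assoc, hμℓ, one_mul]
  · rw [h116 _ hsq, mul_zero, mul_zero, mul_zero]

/-- `τ_k(n) ≤ τ_{k+1}(n)` for `n ≥ 1` (`τ_{k+1}(n) = ∑_{d ∣ n} τ_k(d)`). [folklore] -/
theorem divisorCountK_le_succ (k : ℕ) {n : ℕ} (hn : n ≠ 0) : divisorCountK k n ≤ divisorCountK (k + 1) n := by
  rw [divisorCountK_succ_apply]
  exact Finset.single_le_sum (f := fun d => divisorCountK k d) (fun _ _ => Nat.zero_le _)
    (Nat.mem_divisors_self n hn)

/-- `τ₃ ≤ τ₅` on `n ≥ 1`. [folklore] -/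
theorem divisorCountK_three_le_five {n : ℕ} (hn : n ≠ 0) : divisorCountK 3 n ≤ divisorCountK 5 n :=
  (divisorCountK_le_succ 3 hn).trans (divisorCountK_le_succ 4 hn)

/-- **(B′) on the dyadic pieces** (FI §7: "`≤ (log x) ∫_{Y/Δ}^{eY} ∑_ℓ τ₃(ℓ) |∑_{y<b≤sy} μ(b) a_{bℓ}|
dy/y`. By (B′) we conclude that (7.2)"): if each of the `k₀` dyadic pieces `N = 2^i u` satisfies the
bound (B′) `∑_m τ₅(m)|∑_{N<n≤2N, mn≤x} γ(n;1)μ(mn)a_{mn}| ≤ K_B`, then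
`∑_{ℓ ≤ x} τ₃(ℓ) |∑_{b ≤ x/ℓ, u < b ≤ 2^{k₀}u} μ(b) a_{bℓ}| ≤ k₀ K_B`.
[cite: FriedlanderIwaniecASP1998, §7 (7.1)-(7.2)] -/
theorem SieveSequence.sum_tau3_abs_inner_le (A : SieveSequence)
    (h116 : ∀ n : ℕ, ¬Squarefree n → A.a n = 0) {x : ℝ} (hx : 0 ≤ x) {u : ℝ} (hu : 0 ≤ u) (k₀ : ℕ)
    {KB : ℝ}
    (hB : ∀ i ∈ range k₀, ∑ m ∈ Icc 1 ⌊x⌋₊, (divisorCountK 5 m : ℝ) *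
      |∑ n ∈ (Ioc ⌊2 ^ i * u⌋₊ ⌊2 * (2 ^ i * u)⌋₊).filter (fun n : ℕ => ((m * n : ℕ) : ℝ) ≤ x),
        (SieveSequence.fiGamma 1 n : ℝ) * (μ (m * n) : ℝ) * A.a (m * n)| ≤ KB) :
    ∑ ℓ ∈ Icc 1 ⌊x⌋₊, (divisorCountK 3 ℓ : ℝ) *
        |∑ b ∈ Icc 1 (⌊x⌋₊ / ℓ), (if u < (b : ℝ) ∧ (b : ℝ) ≤ 2 ^ k₀ * u then (μ b : ℝ) * A.a (b * ℓ) else 0)|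
      ≤ k₀ * KB := by
  classical
  set T : ℕ → ℕ → ℝ := fun i m =>
    |∑ n ∈ (Ioc ⌊2 ^ i * u⌋₊ ⌊2 * (2 ^ i * u)⌋₊).filter (fun n : ℕ => ((m * n : ℕ) : ℝ) ≤ x),
      (SieveSequence.fiGamma 1 n : ℝ) * (μ (m * n) : ℝ) * A.a (m * n)| with hT
  -- each `|Ψ(ℓ, u)| ≤ ∑_i T i ℓ`
  have hΨ : ∀ ℓ ∈ Icc 1 ⌊x⌋₊,
      |∑ b ∈ Icc 1 (⌊x⌋₊ / ℓ), (if u < (b : ℝ) ∧ (b : ℝ) ≤ 2 ^ k₀ * u then (μ b : ℝ) * A.a (b * ℓ) else 0)|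
        ≤ ∑ i ∈ range k₀, T i ℓ := by
    intro ℓ hℓ
    have hℓ1 : 1 ≤ ℓ := (Finset.mem_Icc.mp hℓ).1
    rw [sum_ite_Ioc_pow_eq_sum_range (fun b => (μ b : ℝ) * A.a (b * ℓ)) hu k₀ hx hℓ1]
    refine (Finset.abs_sum_le_sum_abs _ _).trans (Finset.sum_le_sum fun i _ => ?_)
    have hS : ∀ n ∈ (Ioc ⌊2 ^ i * u⌋₊ ⌊2 * (2 ^ i * u)⌋₊).filter (fun n : ℕ => ((ℓ * n : ℕ) : ℝ) ≤ x),
        n ≠ 0 := by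
      intro n hn
      have := (Finset.mem_Ioc.mp (Finset.mem_filter.mp hn).1).1
      omega
    rw [sum_moebius_mul_a_eq h116 ℓ _ hS, abs_mul]
    have hμ : |(μ ℓ : ℝ)| ≤ 1 := by exact_mod_cast ArithmeticFunction.abs_moebius_le_one
    calc |(μ ℓ : ℝ)| * T i ℓ ≤ 1 * T i ℓ := mul_le_mul_of_nonneg_right hμ (abs_nonneg _)
      _ = T i ℓ := one_mul _
  calc ∑ ℓ ∈ Icc 1 ⌊x⌋₊, (divisorCountK 3 ℓ : ℝ) *
        |∑ b ∈ Icc 1 (⌊x⌋₊ / ℓ), (if u < (b : ℝ) ∧ (b : ℝ) ≤ 2 ^ k₀ * u then (μ b : ℝ) * A.a (b * ℓ) else 0)|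
      ≤ ∑ ℓ ∈ Icc 1 ⌊x⌋₊, (divisorCountK 5 ℓ : ℝ) * ∑ i ∈ range k₀, T i ℓ := by
        refine Finset.sum_le_sum fun ℓ hℓ => ?_
        have hℓ0 : ℓ ≠ 0 := by have := (Finset.mem_Icc.mp hℓ).1; omega
        refine mul_le_mul ?_ (hΨ ℓ hℓ) (abs_nonneg _) (Nat.cast_nonneg _)
        exact_mod_cast divisorCountK_three_le_five hℓ0
    _ = ∑ i ∈ range k₀, ∑ ℓ ∈ Icc 1 ⌊x⌋₊, (divisorCountK 5 ℓ : ℝ) * T i ℓ := by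
        rw [Finset.sum_comm]
        exact Finset.sum_congr rfl fun ℓ _ => by rw [Finset.mul_sum]
    _ ≤ ∑ i ∈ range k₀, KB := Finset.sum_le_sum fun i hi => hB i hi
    _ = k₀ * KB := by rw [Finset.sum_const, Finset.card_range, nsmul_eq_mul]


/-! ### Integrability helpers -/

/-- A finite sum of interval integrable functions, as a lambda. [folklore] -/
theorem intervalIntegrable_finset_sum_fun {ι : Type*} (s : Finset ι) {f : ι → ℝ → ℝ} {a b : ℝ}
    (h : ∀ i ∈ s, IntervalIntegrable (f i) volume a b) :
    IntervalIntegrable (fun y => ∑ i ∈ s, f i y) volume a b := by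
  have : (fun y => ∑ i ∈ s, f i y) = ∑ i ∈ s, f i := by
    ext y
    simp only [Finset.sum_apply]
  rw [this]
  exact IntervalIntegrable.sum s h

/-- For `h` measurable with `|h| ≤ M` and `0 < a ≤ b`, `y ↦ h(y/ν)/y` is interval integrable on
`[a, b]`. [folklore] -/
theorem intervalIntegrable_comp_div_div {h : ℝ → ℝ} (hm : Measurable h) {M : ℝ}
    (hM : ∀ u, |h u| ≤ M) (ν : ℝ) {a b : ℝ} (ha : 0 < a) (hab : a ≤ b) :
    IntervalIntegrable (fun y => h (y / ν) / y) volume a b := by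
  refine intervalIntegrable_of_abs_le ((hm.comp (measurable_id.div_const ν)).div measurable_id)
    (M := M / a) fun t ht => ?_
  rw [Set.uIoc_of_le hab] at ht
  have ht0 : 0 < t := ha.trans ht.1
  have hM0 : 0 ≤ M := (abs_nonneg _).trans (hM 0)
  show |h (t / ν) / t| ≤ M / a
  rw [abs_div, abs_of_pos ht0]
  calc |h (t / ν)| / t ≤ M / t := div_le_div_of_nonneg_right (hM _) ht0.le
    _ ≤ M / a := div_le_div_of_nonneg_left hM0 ha ht.1.le

/-- If `2^k ≤ x²` then `k ≤ 4 log x` (`log 2 > 1/2`; Mathlib's `log x = log |x|`). [folklore] -/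
theorem nat_le_four_mul_log_of_two_pow_le {k : ℕ} {x : ℝ} (h : (2 : ℝ) ^ k ≤ x ^ 2) :
    (k : ℝ) ≤ 4 * Real.log x := by
  have h2 : (k : ℝ) * Real.log 2 ≤ 2 * Real.log x := by
    have := Real.log_le_log (by positivity) h
    rw [Real.log_pow, Real.log_pow] at this
    exact_mod_cast this
  have hlog2 : (1 / 2 : ℝ) < Real.log 2 := by have := Real.log_two_gt_d9; linarith
  have hk : (0 : ℝ) ≤ k := Nat.cast_nonneg k
  nlinarith [mul_le_mul_of_nonneg_left hlog2.le hk]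

/-! ### Assembly: (7.2) -/

/-- **FI (7.2): `S₂(x; Y, z) ≪ A(x)(log x)^{-1}`** — discharge of the named fact
`fi_asp_S2_estimate` (no input beyond the hypotheses of Theorem 1). FI §7: "`|S₂(x; y, z)| ≤ (log x)
∑_{ν₁}∑_{ν₂} |λ_{ν₁ν₂}| ∑_k |∑_{y/ν₂<b≤sy/ν₂} μ(b) a_{ν₂bk}|`. In order to remove `ν₂` from the
range of the inner summation we take advantage of the integration over `y` (still not integrating
over `z`). (7.1) `S₂(x; Y, z) ≤ (log x) ∑∑ |λ_{ν₁ν₂}| ∑_k ∫_{Y/Δ}^{eY} |∑_{y<b≤sy} μ(b) a_{ν₂bk}| dy/y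
≤ (log x) ∫_{Y/Δ}^{eY} ∑_ℓ τ₃(ℓ) |∑_{y<b≤sy} μ(b) a_{bℓ}| dy/y`. By (B′) we conclude that (7.2)
`S₂(x; Y, z) ≪ A(x)(log x)^{-1}`." Here: the pointwise bound `SieveSequence.abs_fiS2_le`, the
change of variables `intervalIntegral_comp_div_le` (level `Δ = x^{θ/2}`, so `Y/Δ = Δ_B⁻¹√D` is
exactly the lower end of (B1) for `Δ_B = x^θ`), the reindexing `sum_card_divisors_mul_sum_le`,
the `log₂ s` dyadic pieces `(2^i u, 2^{i+1} u] ⊂ (Δ_B⁻¹√D, δ⁻¹√x)` of `(u, su]`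
(`SieveSequence.sum_tau3_abs_inner_le`), and (B′) in the form
`FIAsymptoticSieveHypotheses.reduced_bilinear_bound_pow` with the saving `(log x)^{-5}` (the three
factors `log x`, `∫_{Y/Δ}^{eY} dy/y = 1 + log Δ` and `log₂ s` are each `≪ log x`), giving
`|S₂(x; Y, z)| ≤ 8K A(x)(log x)^{-2} ≤ 8K A(x)(log x)^{-1}`.
[cite: FriedlanderIwaniecASP1998, §7 (7.1)-(7.2)] -/
theorem fi_asp_S2_estimate_holds : fi_asp_S2_estimate := by
  intro A D α θ θ₁ lam hreg
  classical
  have hhyp := hreg.hyp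
  have h116 : ∀ n : ℕ, ¬Squarefree n → A.a n = 0 := hhyp.2.2.2.2.2.1
  obtain ⟨KB, hKB⟩ := hhyp.reduced_bilinear_bound_pow (k := 5) (by norm_num)
  have hθ : 0 < θ := by linarith [hreg.θ₁_pos, hreg.θ₁_le]
  have hθ3 : θ < 1 / 3 := hreg.θ_lt
  have hα : 0 < α := hreg.α_pos
  set K₀ := max KB 0 with hK₀
  have hK₀0 : 0 ≤ K₀ := le_max_right _ _
  have hKBK₀ : KB ≤ K₀ := le_max_left _ _
  refine ⟨8 * K₀, ?_⟩
  have hR1 : ∀ᶠ x : ℝ in atTop, x ^ (2 / 3 : ℝ) < D x ∧ D x < x :=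
    hhyp.2.2.2.2.2.2.1.mono fun x hx => ⟨hx.1, hx.2.1⟩
  filter_upwards [hreg.weights, hKB, hR1, eventually_ge_atTop (Real.exp 1)] with x hw hBx hR1x hxe
  intro s hs z _hYz _hzY
  -- basics at `x`
  have he1 : (1 : ℝ) ≤ Real.exp 1 := by linarith [Real.add_one_le_exp (1 : ℝ)]
  have hx1 : 1 ≤ x := he1.trans hxe
  have hx0 : 0 < x := by linarith
  have hlogx : 1 ≤ Real.log x := by rw [Real.le_log_iff_exp_le hx0]; exact hxe
  have hlogx0 : 0 < Real.log x := by linarith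
  have hD1 : 1 ≤ D x := le_trans (Real.one_le_rpow hx1 (by norm_num)) hR1x.1.le
  have hD0 : 0 < D x := by linarith
  have hDx : D x < x := hR1x.2
  have hxD1 : (1 : ℝ) ≤ x / D x := (one_le_div hD0).mpr hDx.le
  have hA0 : 0 ≤ A.size x := by rw [hhyp.size_eq]; exact A.congrSum_nonneg 1 x
  set L := x ^ (θ / 2) with hLdef
  have hL1 : 1 ≤ L := Real.one_le_rpow hx1 (by linarith)
  have hL0 : 0 < L := by linarith
  have hLx : L ≤ x := by
    calc L = x ^ (θ / 2) := rfl
      _ ≤ x ^ (1 : ℝ) := Real.rpow_le_rpow_of_exponent_le hx1 (by linarith)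
      _ = x := Real.rpow_one x
  have hxθ0 : x ^ (θ / 2) ≠ 0 := hL0.ne'
  have hsD0 : Real.sqrt (D x) ≠ 0 := (Real.sqrt_pos.mpr hD0).ne'
  have hlα1 : 1 ≤ Real.log x ^ α := Real.one_le_rpow hlogx hα.le
  have hlα0 : Real.log x ^ α ≠ 0 := by positivity
  set Y := fiY D θ x with hYdef
  obtain ⟨hY0, -⟩ :=
    fiY_pos_and_ge (D := D) (θ := θ) (θ₁ := 1 / 3 - θ / 2) hx1 hR1x.1 le_rfl
  have hYe : Y ≤ Real.exp 1 * Y := le_mul_of_one_le_left hY0.le he1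
  have hYL0 : 0 < Y / L := div_pos hY0 hL0
  have hYLe : Y / L ≤ Real.exp 1 * Y := (div_le_self hY0.le hL1).trans hYe
  have hYL_eq : Y / L = Real.sqrt (D x) / x ^ θ := by
    show fiY D θ x / x ^ (θ / 2) = Real.sqrt (D x) / x ^ θ
    rw [fiY, div_div, ← Real.rpow_add hx0, add_halves]
  have hSY : fiSLow D α θ x * Y = Real.sqrt x / (8 * Real.log x ^ α) := by
    show fiSLow D α θ x * fiY D θ x = Real.sqrt x / (8 * Real.log x ^ α)
    have hb : 8 * Real.log x ^ α * Real.sqrt (D x) * x ^ (θ / 2) ≠ 0 :=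
      mul_ne_zero (mul_ne_zero (mul_ne_zero (by norm_num) hlα0) hsD0) hxθ0
    have hd : (8 * Real.log x ^ α) ≠ 0 := mul_ne_zero (by norm_num) hlα0
    rw [fiSLow, fiY, div_mul_div_comm, div_eq_div_iff hb hd]
    ring
  have hfiSLow_le : fiSLow D α θ x ≤ x ^ 2 / 8 := by
    unfold fiSLow
    rw [div_le_div_iff₀ (by positivity) (by norm_num : (0 : ℝ) < 8)]
    have h2 : Real.sqrt x ≤ x := Real.sqrt_le_self_iff.mpr (Or.inr hx1)
    have h4 : 1 ≤ Real.sqrt (D x) := Real.one_le_sqrt.mpr hD1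
    have hsx0 : 0 ≤ Real.sqrt x := Real.sqrt_nonneg x
    calc x ^ (θ / 2) * Real.sqrt x * 8 ≤ x * x * (8 * 1 * 1) := by
          nlinarith [mul_le_mul hLx h2 hsx0 hx0.le]
      _ ≤ x ^ 2 * (8 * Real.log x ^ α * Real.sqrt (D x)) := by
          rw [sq]
          gcongr
  -- the splitting parameter `s = 2^{k₀}`
  obtain ⟨⟨k₀, rfl⟩, _hslow, hsup⟩ := hs
  have hk₀ : (k₀ : ℝ) ≤ 4 * Real.log x := by
    refine nat_le_four_mul_log_of_two_pow_le ?_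
    nlinarith [hsup, hfiSLow_le]
  set X := ⌊x⌋₊ with hXdef
  -- the inner sums `Ψ(ℓ, u) = ∑_{b ≤ X/ℓ, u < b ≤ su} μ(b) a_{bℓ}`
  set Ψ : ℕ → ℝ → ℝ := fun ℓ u => ∑ b ∈ Icc 1 (X / ℓ),
      (if u < (b : ℝ) ∧ (b : ℝ) ≤ 2 ^ k₀ * u then (μ b : ℝ) * A.a (b * ℓ) else 0) with hΨdef
  have hΨm : ∀ ℓ, Measurable (Ψ ℓ) := fun ℓ => A.measurable_innerS2 X ℓ (2 ^ k₀)
  have hΨb : ∀ ℓ u, |Ψ ℓ u| ≤ ∑ b ∈ Icc 1 (X / ℓ), A.a (b * ℓ) := fun ℓ u =>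
    A.abs_innerS2_le X ℓ (2 ^ k₀) u
  have hΨam : ∀ ℓ, Measurable fun u => |Ψ ℓ u| := fun ℓ => continuous_abs.measurable.comp (hΨm ℓ)
  have hΨab : ∀ ℓ u, |(fun u => |Ψ ℓ u|) u| ≤ ∑ b ∈ Icc 1 (X / ℓ), A.a (b * ℓ) := fun ℓ u => by
    simpa only [abs_abs] using hΨb ℓ u
  have hJX : ∀ ℓ, X < ℓ → ∀ u, |Ψ ℓ u| = 0 := by
    intro ℓ hℓ u
    have hI : Icc 1 (X / ℓ) = ∅ := by
      rw [Nat.div_eq_of_lt hℓ]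
      exact Finset.Icc_eq_empty_of_lt zero_lt_one
    simp only [hΨdef, hI, Finset.sum_empty, abs_zero]
  -- integrability of the pieces
  have hpiece : ∀ (ℓ : ℕ) (ν : ℝ) {a b : ℝ}, 0 < a → a ≤ b →
      IntervalIntegrable (fun y => |Ψ ℓ (y / ν)| / y) volume a b := fun ℓ ν a b ha hab =>
    intervalIntegrable_comp_div_div (h := fun u => |Ψ ℓ u|) (hΨam ℓ) (hΨab ℓ) ν ha hab
  have hpiece1 : ∀ (ℓ : ℕ) {a b : ℝ}, 0 < a → a ≤ b →
      IntervalIntegrable (fun u => |Ψ ℓ u| / u) volume a b := fun ℓ a b ha hab => by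
    simpa only [div_one] using hpiece ℓ 1 ha hab
  -- the weights `c_k = (log x) τ(k)` and the constants
  set c : ℕ → ℝ := fun k => Real.log x * (k.divisors.card : ℝ) with hcdef
  have hc0 : ∀ k, 0 ≤ c k := fun k => mul_nonneg hlogx0.le (Nat.cast_nonneg _)
  set KB' : ℝ := K₀ * A.size x / Real.log x ^ 5 with hKB'
  have hKB'0 : 0 ≤ KB' := by positivity
  set M₀ : ℝ := k₀ * KB' with hM₀
  -- (B′) on the dyadic pieces, for `u ∈ (Y/Δ, eY)`
  have hB' : ∀ u ∈ Set.Ioo (Y / L) (Real.exp 1 * Y), ∀ i ∈ range k₀,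
      ∑ m ∈ Icc 1 ⌊x⌋₊, (divisorCountK 5 m : ℝ) *
        |∑ n ∈ (Ioc ⌊2 ^ i * u⌋₊ ⌊2 * (2 ^ i * u)⌋₊).filter (fun n : ℕ => ((m * n : ℕ) : ℝ) ≤ x),
          (SieveSequence.fiGamma 1 n : ℝ) * (μ (m * n) : ℝ) * A.a (m * n)| ≤ KB' := by
    intro u hu i hi
    have hi' : i < k₀ := Finset.mem_range.mp hi
    have hu0 : 0 < u := hYL0.trans hu.1
    have hN1 : Real.sqrt (D x) / x ^ θ < 2 ^ i * u := by
      calc Real.sqrt (D x) / x ^ θ = Y / L := hYL_eq.symm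
        _ < u := hu.1
        _ ≤ 2 ^ i * u := le_mul_of_one_le_left hu0.le (one_le_pow₀ one_le_two)
    have h2i : (2 : ℝ) ^ i ≤ 2 ^ k₀ / 2 := by
      rw [le_div_iff₀ two_pos, ← pow_succ]
      exact pow_le_pow_right₀ one_le_two (Nat.succ_le_of_lt hi')
    have hq : 0 < Real.sqrt x / Real.log x ^ α := div_pos (Real.sqrt_pos.mpr hx0) (by positivity)
    have he8 : Real.exp 1 / 8 < 1 := by have := Real.exp_one_lt_d9; linarith
    have hN2 : 2 ^ i * u < Real.sqrt x / Real.log x ^ α := by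
      calc 2 ^ i * u ≤ 2 ^ i * (Real.exp 1 * Y) := mul_le_mul_of_nonneg_left hu.2.le (by positivity)
        _ ≤ (2 ^ k₀ / 2) * (Real.exp 1 * Y) := mul_le_mul_of_nonneg_right h2i (by positivity)
        _ ≤ fiSLow D α θ x * (Real.exp 1 * Y) :=
            mul_le_mul_of_nonneg_right (by linarith [hsup]) (by positivity)
        _ = (Real.exp 1 / 8) * (Real.sqrt x / Real.log x ^ α) := by
            rw [show fiSLow D α θ x * (Real.exp 1 * Y) = Real.exp 1 * (fiSLow D α θ x * Y) by ring,
              hSY]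
            field_simp
        _ < 1 * (Real.sqrt x / Real.log x ^ α) := mul_lt_mul_of_pos_right he8 hq
        _ = Real.sqrt x / Real.log x ^ α := one_mul _
    have h0 := hBx (2 ^ i * u) hN1 hN2 1 le_rfl hxD1
    refine h0.trans ?_
    rw [hKB']
    exact div_le_div_of_nonneg_right (mul_le_mul_of_nonneg_right hKBK₀ hA0) (by positivity)
  -- Step (A): `|∫ S₂ dy/y| ≤ ∫ G dy`
  set G : ℝ → ℝ := fun y => ∑ k ∈ Icc 1 X, ∑ ν ∈ Icc 1 ⌊L⌋₊, c k * (|Ψ (ν * k) (y / ν)| / y)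
    with hGdef
  have hGalt : ∀ y, G y = (Real.log x * ∑ k ∈ Icc 1 X, (k.divisors.card : ℝ) *
      ∑ ν ∈ Icc 1 ⌊L⌋₊, |Ψ (ν * k) (y / ν)|) / y := by
    intro y
    simp only [hGdef, hcdef]
    rw [Finset.mul_sum, Finset.sum_div]
    refine Finset.sum_congr rfl fun k _ => ?_
    rw [Finset.mul_sum, Finset.mul_sum, Finset.sum_div]
    refine Finset.sum_congr rfl fun ν _ => ?_
    ring
  have hGint : IntervalIntegrable G volume Y (Real.exp 1 * Y) := by
    refine intervalIntegrable_finset_sum_fun _ fun k _ => ?_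
    refine intervalIntegrable_finset_sum_fun _ fun ν _ => ?_
    exact (hpiece (ν * k) ν hY0 hYe).const_mul _
  have hpt : ∀ᵐ y : ℝ, y ∈ Set.Ioc Y (Real.exp 1 * Y) →
      ‖A.fiS2 (lam x) (2 ^ k₀) x y z / y‖ ≤ G y := by
    refine Filter.Eventually.of_forall fun y hy => ?_
    have hy0 : 0 < y := hY0.trans hy.1
    rw [Real.norm_eq_abs, abs_div, abs_of_pos hy0, hGalt y]
    refine div_le_div_of_nonneg_right ?_ hy0.le
    exact A.abs_fiS2_le h116 hw hL0.le hx1 (2 ^ k₀) y z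
  have hA : |A.fiS2Y (lam x) (2 ^ k₀) x Y z| ≤ ∫ y in Y..(Real.exp 1 * Y), G y := by
    have h := intervalIntegral.norm_integral_le_of_norm_le
      (f := fun y => A.fiS2 (lam x) (2 ^ k₀) x y z / y) hYe hpt hGint
    rw [Real.norm_eq_abs] at h
    simpa only [SieveSequence.fiS2Y, SieveSequence.logAvg] using h
  -- Step (B): push the integral through the finite sums
  have hBeq : ∫ y in Y..(Real.exp 1 * Y), G y =
      ∑ k ∈ Icc 1 X, ∑ ν ∈ Icc 1 ⌊L⌋₊, c k * ∫ y in Y..(Real.exp 1 * Y), |Ψ (ν * k) (y / ν)| / y := by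
    simp only [hGdef]
    rw [intervalIntegral.integral_finsetSum (fun k _ =>
      intervalIntegrable_finset_sum_fun _ fun ν _ => (hpiece (ν * k) ν hY0 hYe).const_mul _)]
    refine Finset.sum_congr rfl fun k _ => ?_
    rw [intervalIntegral.integral_finsetSum (fun ν _ => (hpiece (ν * k) ν hY0 hYe).const_mul _)]
    refine Finset.sum_congr rfl fun ν _ => ?_
    exact intervalIntegral.integral_const_mul _ _
  -- Step (C): the change of variables `u = y/ν₂`, `1 ≤ ν₂ ≤ Δ`
  have hCle : (∑ k ∈ Icc 1 X, ∑ ν ∈ Icc 1 ⌊L⌋₊,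
        c k * ∫ y in Y..(Real.exp 1 * Y), |Ψ (ν * k) (y / ν)| / y) ≤
      ∑ k ∈ Icc 1 X, ∑ ν ∈ Icc 1 ⌊L⌋₊,
        c k * ∫ u in (Y / L)..(Real.exp 1 * Y), |Ψ (ν * k) u| / u := by
    refine Finset.sum_le_sum fun k _ => Finset.sum_le_sum fun ν hν => ?_
    refine mul_le_mul_of_nonneg_left ?_ (hc0 k)
    obtain ⟨hν1, hνL⟩ := Finset.mem_Icc.mp hν
    exact intervalIntegral_comp_div_le (h := fun u => |Ψ (ν * k) u|) (hΨam _)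
      (fun u => abs_nonneg _) (fun u => hΨb _ u) hY0 (by exact_mod_cast hν1)
      ((Nat.cast_le.mpr hνL).trans (Nat.floor_le hL0.le))
  -- Step (D): pull the finite sums back inside
  have hDeq : (∑ k ∈ Icc 1 X, ∑ ν ∈ Icc 1 ⌊L⌋₊,
        c k * ∫ u in (Y / L)..(Real.exp 1 * Y), |Ψ (ν * k) u| / u) =
      ∫ u in (Y / L)..(Real.exp 1 * Y),
        ∑ k ∈ Icc 1 X, ∑ ν ∈ Icc 1 ⌊L⌋₊, c k * (|Ψ (ν * k) u| / u) := by
    rw [intervalIntegral.integral_finsetSum (fun k _ =>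
      intervalIntegrable_finset_sum_fun _ fun ν _ => (hpiece1 (ν * k) hYL0 hYLe).const_mul _)]
    refine Finset.sum_congr rfl fun k _ => ?_
    rw [intervalIntegral.integral_finsetSum (fun ν _ => (hpiece1 (ν * k) hYL0 hYLe).const_mul _)]
    refine Finset.sum_congr rfl fun ν _ => ?_
    exact (intervalIntegral.integral_const_mul _ _).symm
  -- Step (E): the pointwise bound by `τ₃` and (B′), then `∫_{Y/Δ}^{eY} du/u = 1 + log Δ`
  have hpt2 : ∀ u ∈ Set.Ioo (Y / L) (Real.exp 1 * Y),
      (∑ k ∈ Icc 1 X, ∑ ν ∈ Icc 1 ⌊L⌋₊, c k * (|Ψ (ν * k) u| / u)) ≤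
        Real.log x * M₀ * u⁻¹ := by
    intro u hu
    have hu0 : 0 < u := hYL0.trans hu.1
    have hsum1 : (∑ k ∈ Icc 1 X, (k.divisors.card : ℝ) * ∑ ν ∈ Icc 1 ⌊L⌋₊, |Ψ (ν * k) u|) ≤
        ∑ ℓ ∈ Icc 1 X, (divisorCountK 3 ℓ : ℝ) * |Ψ ℓ u| :=
      sum_card_divisors_mul_sum_le (J := fun ℓ => |Ψ ℓ u|) (fun ℓ => abs_nonneg _)
        (fun ℓ hℓ => hJX ℓ hℓ u) ⌊L⌋₊
    have hsum2 : (∑ ℓ ∈ Icc 1 X, (divisorCountK 3 ℓ : ℝ) * |Ψ ℓ u|) ≤ k₀ * KB' :=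
      A.sum_tau3_abs_inner_le h116 hx0.le hu0.le k₀ (hB' u hu)
    have heq : (∑ k ∈ Icc 1 X, ∑ ν ∈ Icc 1 ⌊L⌋₊, c k * (|Ψ (ν * k) u| / u)) =
        (Real.log x * u⁻¹) *
          ∑ k ∈ Icc 1 X, (k.divisors.card : ℝ) * ∑ ν ∈ Icc 1 ⌊L⌋₊, |Ψ (ν * k) u| := by
      rw [Finset.mul_sum]
      refine Finset.sum_congr rfl fun k _ => ?_
      rw [Finset.mul_sum, Finset.mul_sum]
      refine Finset.sum_congr rfl fun ν _ => ?_
      simp only [hcdef]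
      rw [div_eq_mul_inv]
      ring
    rw [heq]
    calc Real.log x * u⁻¹ *
          ∑ k ∈ Icc 1 X, (k.divisors.card : ℝ) * ∑ ν ∈ Icc 1 ⌊L⌋₊, |Ψ (ν * k) u|
        ≤ Real.log x * u⁻¹ * (k₀ * KB') :=
          mul_le_mul_of_nonneg_left (hsum1.trans hsum2) (by positivity)
      _ = Real.log x * M₀ * u⁻¹ := by rw [hM₀]; ring
  have hinv : IntervalIntegrable (fun u : ℝ => Real.log x * M₀ * u⁻¹) volume (Y / L)
      (Real.exp 1 * Y) := by
    refine (intervalIntegral.intervalIntegrable_inv (fun u hu => ?_) continuousOn_id).const_mul _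
    rw [Set.uIcc_of_le hYLe] at hu
    exact (hYL0.trans_le hu.1).ne'
  have hEle : (∫ u in (Y / L)..(Real.exp 1 * Y),
        ∑ k ∈ Icc 1 X, ∑ ν ∈ Icc 1 ⌊L⌋₊, c k * (|Ψ (ν * k) u| / u)) ≤
      ∫ u in (Y / L)..(Real.exp 1 * Y), Real.log x * M₀ * u⁻¹ := by
    refine intervalIntegral.integral_mono_on_of_le_Ioo hYLe ?_ hinv hpt2
    exact intervalIntegrable_finset_sum_fun _ fun k _ =>
      intervalIntegrable_finset_sum_fun _ fun ν _ => (hpiece1 (ν * k) hYL0 hYLe).const_mul _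
  have hEeq : (∫ u in (Y / L)..(Real.exp 1 * Y), Real.log x * M₀ * u⁻¹) =
      Real.log x * M₀ * (1 + Real.log L) := by
    rw [intervalIntegral.integral_const_mul,
      integral_inv (Set.notMem_uIcc_of_lt hYL0 (by positivity))]
    congr 1
    have : Real.exp 1 * Y / (Y / L) = Real.exp 1 * L := by
      rw [div_div_eq_mul_div, mul_assoc, mul_comm Y L, ← mul_assoc, mul_div_assoc, div_self hY0.ne',
        mul_one]
    rw [this, Real.log_mul (Real.exp_pos 1).ne' hL0.ne', Real.log_exp]
  -- Step (F): numerics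
  have hlogL : 1 + Real.log L ≤ 2 * Real.log x := by
    have : Real.log L ≤ Real.log x := Real.log_le_log hL0 hLx
    linarith
  have hlogL0 : 0 ≤ 1 + Real.log L := by
    have : 0 ≤ Real.log L := Real.log_nonneg hL1
    linarith
  have hF : Real.log x * M₀ * (1 + Real.log L) ≤ 8 * K₀ * A.size x / Real.log x := by
    have h1 : (k₀ : ℝ) * (1 + Real.log L) ≤ 4 * Real.log x * (2 * Real.log x) :=
      mul_le_mul hk₀ hlogL hlogL0 (by positivity)
    calc Real.log x * M₀ * (1 + Real.log L)
        = (KB' * Real.log x) * ((k₀ : ℝ) * (1 + Real.log L)) := by rw [hM₀]; ring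
      _ ≤ (KB' * Real.log x) * (4 * Real.log x * (2 * Real.log x)) :=
          mul_le_mul_of_nonneg_left h1 (by positivity)
      _ = 8 * (K₀ * A.size x) / Real.log x ^ 2 := by
          rw [hKB']
          field_simp
          ring
      _ ≤ 8 * (K₀ * A.size x) / Real.log x := by
          refine div_le_div_of_nonneg_left (by positivity) hlogx0 ?_
          calc Real.log x = Real.log x ^ 1 := (pow_one _).symm
            _ ≤ Real.log x ^ 2 := pow_le_pow_right₀ hlogx (by norm_num)
      _ = 8 * K₀ * A.size x / Real.log x := by ring
  -- conclusion
  calc |A.fiS2Y (lam x) (2 ^ k₀) x Y z| ≤ ∫ y in Y..(Real.exp 1 * Y), G y := hA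
    _ = ∑ k ∈ Icc 1 X, ∑ ν ∈ Icc 1 ⌊L⌋₊,
          c k * ∫ y in Y..(Real.exp 1 * Y), |Ψ (ν * k) (y / ν)| / y := hBeq
    _ ≤ ∑ k ∈ Icc 1 X, ∑ ν ∈ Icc 1 ⌊L⌋₊,
          c k * ∫ u in (Y / L)..(Real.exp 1 * Y), |Ψ (ν * k) u| / u := hCle
    _ = ∫ u in (Y / L)..(Real.exp 1 * Y),
          ∑ k ∈ Icc 1 X, ∑ ν ∈ Icc 1 ⌊L⌋₊, c k * (|Ψ (ν * k) u| / u) := hDeq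
    _ ≤ ∫ u in (Y / L)..(Real.exp 1 * Y), Real.log x * M₀ * u⁻¹ := hEle
    _ = Real.log x * M₀ * (1 + Real.log L) := hEeq
    _ ≤ 8 * K₀ * A.size x / Real.log x := hF

end Literature.NumberTheory.Sieve
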